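import Summits.CriticalPhenomena.SAWScalingLimit.Theorems.SAWLoopFugacityFlowAvoidanceLimitSphereRatioLimitContinuum

/-!
# `stub_interiorRatioLimit` (INT) reduced to interior convergence of the killed-SRW Green's functions
— helper file 1 of stub `stub_interiorRatioLimit` (S3b-INT) of line `symplectic-fermion-anchor`
(crux `SAWLoopFugacityFlow.AvoidanceLimit`, stmt-CriticalPhenomena-10649)

The stub (INT of the assembly `stub_sphereRatioLimit_of_oscillation_of_interiorLimit`): at distinct
interior reference points `z*, y* ∈ D'` the ratio of killed simple-random-walk Green's functions
`F_δ(u,v) = G^c_δ(u,v)/G_δ(u,v)` ("walk confined to `closure D'`" over "walk in `Ω_δ`", common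
volume `Λ = meshDomainFinset D δ`) tends to the ratio of continuum Green's functions
`ρ(z*,y*) = G_{D'}(z*,y*)/G_D(z*,y*)`, written through the chordal uniformizer `φ : ℍ → D` and the
restriction map `Φ = Φ_A : ℍ ∖ A → ℍ` of the pulled-back hull `A = closure (ℍ ∖ φ⁻¹D')`:
`G_D(z,y) = G_ℍ(φ⁻¹z, φ⁻¹y)`, `G_{D'}(z,y) = G_ℍ(Φφ⁻¹z, Φφ⁻¹y)`, `G_ℍ(x,y) = log(|x − ȳ|/|x − y|)`.

This file isolates the ONE lattice input this consists of and proves the rest.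
`stub_interiorRatioLimit_of_greenConvergence` (registered sub-goal) derives the registered signature
of the stub from

* (GC) INTERIOR CONVERGENCE OF THE GREEN'S FUNCTION OF THE CONFINED WALK — for Jordan domains
  `D' ⊆ D`, any conformal `ψ : ℍ → D'`, distinct `z*, y* ∈ D'` and `η > 0` there is `s > 0` with,
  for all small `δ`, `|G^c_δ(u,v) − c·G_ℍ(ψ⁻¹z*, ψ⁻¹y*)| ≤ η` for all lattice `u, v` with
  `|δu − z*|, |δv − y*| < s`, where `G^c_δ = greenEntry (confinedGraph D D' δ) (meshDomainFinset D δ)`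
  and `c > 0` is a constant (its value, `c = 2/π` — `greenEntry` is the expected number of visits,
  the 2D potential kernel is `a(x) = (2/π) log|x| + κ + O(|x|⁻²)` — cancels in the ratio, so the
  hypothesis only asks for SOME `c > 0`).

  At `D' = D` the confined graph IS `Ω_δ` (`confinedGraph_self_eq`), so (GC) contains the
  convergence of the denominator `G_δ(u,v) → c·G_D(z*,y*)`; the stub follows by the algebra of a
  ratio of two convergent quantities with positive limit of the denominator
  (`G_ℍ(x,y) > 0` for `x ≠ y` in `ℍ`, `log_norm_sub_conj_div_pos`), applied with
  `ψ = φ ∘ Φ⁻¹ : ℍ → D'` (`Φ.symm.trans (φ.restrHull D')`, whose inverse is `Φ ∘ φ⁻¹` by `rfl`).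

(GC) is D. Chelkak, Y. Wan, Electron. J. Probab. 26 (2021), Prop. 3.2 / Cor. 3.3 (from
D. Chelkak, S. Smirnov, Adv. Math. 228 (2011), Thm. 3.9): `Z_{Ω^δ}(u^δ,v^δ) → G_Ω(u,v)` for simply
connected discrete domains `Ω^δ ⊂ δℤ²` approximating `Ω` in the Carathéodory sense, uniformly for
`u, v` jointly `r`-inside, TRANSPOSED to the tree's walks: print is for INDUCED subgraphs of `δℤ²`
(walk killed at the first VERTEX outside `V(Ω^δ)`; Chelkak–Smirnov §2.1: the continuous counterpart
`F ∪ E ∪ V` is open, so every edge at an interior vertex is an edge of the domain), while the tree's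
`Ω_δ = discreteDomainGraph D δ` and `confinedGraph D D' δ` kill the walk on EDGES whose closed segment
leaves the closure (two live vertices at distance `δ` need not be joined). That extension (Chelkak
2016, toolbox §2.2, "one can easily remove this assumption") is not in print; (GC) is the honest
remaining input of the stub. Not in the tree.

Sources: [ChelkakWan2021] Prop. 3.2, Cor. 3.3 (§3.1); [ChelkakSmirnov2011] Def. 2.6, Thm. 3.9;
G. F. Lawler, V. Limic, *Random Walk: A Modern Introduction* (2010), Thm. 4.4.4, Prop. 4.6.2
(`G_A(x,y) = E^x[a(S_τ − y)] − a(x − y)`) [LawlerLimic2010]. No definitions.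
-/

noncomputable section

open scoped BigOperators Topology symmDiff
open Filter Finset
open Literature.Probability.RandomPlanarGeometry Literature.Probability.LatticeModels

namespace Summit.CriticalPhenomena.SAWScalingLimit.Theorems.AvoidanceLimit.Anchor

/-! ## Two elementary inputs: `G_ℍ > 0`, and the algebra of a ratio of approximations -/

/-- **`G_ℍ(x, y) = log(|x − ȳ|/|x − y|) > 0`** for distinct points `x, y` of the upper half-plane
(`= ½ log(1 + 4 Im x Im y/|x − y|²)`, `log_norm_sub_conj_div`). [folklore] -/
theorem log_norm_sub_conj_div_pos {x y : ℂ} (hxy : x ≠ y) (hx : 0 < x.im) (hy : 0 < y.im) :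
    0 < Real.log (‖x - (starRingEnd ℂ) y‖ / ‖x - y‖) := by
  rw [log_norm_sub_conj_div hxy hx.le hy.le]
  have hn : 0 < ‖x - y‖ := norm_pos_iff.2 (sub_ne_zero.2 hxy)
  have ht : 0 < 4 * x.im * y.im / ‖x - y‖ ^ 2 := by positivity
  have hlog : 0 < Real.log (1 + 4 * x.im * y.im / ‖x - y‖ ^ 2) := Real.log_pos (by linarith)
  linarith

/-- **Ratio of two approximations.** If `|G − a| ≤ e`, `|G' − b| ≤ e` with `0 < a` and
`e ≤ a/2`, then `|G'/G − b/a| ≤ 2e(a + |b|)/a²` (`G ≥ a/2`, and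
`G'/G − b/a = ((G' − b)a + b(a − G))/(Ga)`). [folklore] -/
theorem abs_div_sub_div_le_of_abs_sub_le {G G' a b e : ℝ} (ha : 0 < a) (hG : |G - a| ≤ e)
    (hG' : |G' - b| ≤ e) (he : e ≤ a / 2) : |G' / G - b / a| ≤ 2 * e * (a + |b|) / a ^ 2 := by
  have he0 : 0 ≤ e := (abs_nonneg _).trans hG
  have hGa : a / 2 ≤ G := by
    have h := (abs_le.1 hG).1
    linarith
  have hGpos : 0 < G := lt_of_lt_of_le (half_pos ha) hGa
  have key : G' / G - b / a = ((G' - b) * a + b * (a - G)) / (G * a) := by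
    field_simp
    ring
  have hnum : |(G' - b) * a + b * (a - G)| ≤ e * (a + |b|) := by
    calc |(G' - b) * a + b * (a - G)| ≤ |(G' - b) * a| + |b * (a - G)| := abs_add_le _ _
      _ = |G' - b| * a + |b| * |G - a| := by rw [abs_mul, abs_mul, abs_of_pos ha, abs_sub_comm a G]
      _ ≤ e * a + |b| * e := by gcongr
      _ = e * (a + |b|) := by ring
  rw [key, abs_div, abs_mul, abs_of_pos hGpos, abs_of_pos ha,
    div_le_div_iff₀ (mul_pos hGpos ha) (pow_pos ha 2)]
  have hab : 0 ≤ a + |b| := by positivity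
  calc |(G' - b) * a + b * (a - G)| * a ^ 2 ≤ e * (a + |b|) * a ^ 2 := by gcongr
    _ = 2 * e * (a + |b|) * (a / 2 * a) := by ring
    _ ≤ 2 * e * (a + |b|) * (G * a) := by gcongr

/-! ## Registered sub-goal: INT from interior convergence of the confined Green's function -/

/-- **REDUCTION (registered sub-goal): `stub_interiorRatioLimit` from (GC).** Hypothesis (GC):
for some constant `c > 0`, for all Jordan domains `D' ⊆ D`, every conformal `ψ : ℍ → D'`, all
distinct `z*, y* ∈ D'` and `η > 0`, there is `s > 0` such that for all small mesh `δ` and all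
lattice points `u, v` with `|δu − z*| < s`, `|δv − y*| < s`, the Green's function of the simple
random walk on `Ω_δ(D)` killed when its edge leaves `closure D'`
(`greenEntry (confinedGraph D D' δ) (meshDomainFinset D δ) u v`, the expected number of visits)
is within `η` of `c · G_ℍ(ψ⁻¹z*, ψ⁻¹y*) = c · G_{D'}(z*,y*)` — interior convergence of discrete
Green's functions, Chelkak–Wan 2021 Prop. 3.2 / Cor. 3.3 (Chelkak–Smirnov 2011 Thm. 3.9)
transposed from induced discrete domains to the tree's edge-killed walks, with `c = 2/π`.
Conclusion: the registered signature of `stub_interiorRatioLimit`. Proof: (GC) at `D' = D`,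
`ψ = φ` is the convergence of the denominator (`confinedGraph_self_eq`); (GC) at `(D, D')` with
`ψ = φ ∘ Φ_A⁻¹` that of the numerator (`(Φ.symm.trans (φ.restrHull D')).symm = Φ ∘ φ⁻¹`
definitionally); `G_D(z*,y*) = G_ℍ(φ⁻¹z*, φ⁻¹y*) > 0` as `φ⁻¹z* ≠ φ⁻¹y*` lie in `ℍ`; then
`abs_div_sub_div_le_of_abs_sub_le` with `e = min(a/2, ηa²/(2(a + |b|)))`, `a = c·G_D`,
`b = c·G_{D'}`. The chordal normalisations of `φ`, `Φ`, the ball agreement and the positivity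
guard of the stub are not needed. [cite: ChelkakWan2021, Proposition 3.2 and Corollary 3.3 (§3.1)] -/
theorem stub_interiorRatioLimit_of_greenConvergence :
    (∃ c : ℝ, 0 < c ∧ ∀ (D D' : JordanDomain), D'.carrier ⊆ D.carrier →
      ∀ (ψ : ConformalEquiv UpperHalfPlane.upperHalfPlaneSet D'.carrier),
      ∀ zs ys : ℂ, zs ∈ D'.carrier → ys ∈ D'.carrier → zs ≠ ys →
      ∀ η : ℝ, 0 < η → ∃ s : ℝ, 0 < s ∧ ∀ᶠ δ in 𝓝[>] (0 : ℝ), ∀ u v : Site 2,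
        dist (meshPoint δ u) zs < s → dist (meshPoint δ v) ys < s →
        |greenEntry (confinedGraph D.carrier D'.carrier δ) (meshDomainFinset D.carrier δ) u v -
          c * Real.log (‖ψ.symm zs - (starRingEnd ℂ) (ψ.symm ys)‖ / ‖ψ.symm zs - ψ.symm ys‖)| ≤ η) →
    ∀ (D D' : DobrushinDomain), D'.carrier ⊆ D.carrier → D'.pt 0 = D.pt 0 → D'.pt 1 = D.pt 1 →
      (∃ ε : ℝ, 0 < ε ∧ D'.carrier ∩ Metric.ball (D.pt 0) ε = D.carrier ∩ Metric.ball (D.pt 0) ε ∧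
      D'.carrier ∩ Metric.ball (D.pt 1) ε = D.carrier ∩ Metric.ball (D.pt 1) ε) →
      ∀ (φ : ConformalEquiv UpperHalfPlane.upperHalfPlaneSet D.carrier), D.IsChordalUniformizing φ →
      ∀ (A : Set ℂ), A = closure (UpperHalfPlane.upperHalfPlaneSet \
      {z | z ∈ UpperHalfPlane.upperHalfPlaneSet ∧ φ z ∈ D'.carrier}) →
      ∀ (Φ : ConformalEquiv (UpperHalfPlane.upperHalfPlaneSet \ A) UpperHalfPlane.upperHalfPlaneSet),
      IsRestrictionMap A Φ →
      ∀ zs ys : ℂ, zs ∈ D'.carrier → ys ∈ D'.carrier → zs ≠ ys →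
      ∀ η : ℝ, 0 < η → ∃ s : ℝ, 0 < s ∧ ∀ᶠ δ in 𝓝[>] (0 : ℝ), ∀ u v : Site 2,
      dist (meshPoint δ u) zs < s → dist (meshPoint δ v) ys < s →
      0 < greenEntry (discreteDomainGraph D.carrier δ) (meshDomainFinset D.carrier δ) u v →
      |greenEntry (confinedGraph D.carrier D'.carrier δ) (meshDomainFinset D.carrier δ) u v /
      greenEntry (discreteDomainGraph D.carrier δ) (meshDomainFinset D.carrier δ) u v -
      Real.log (‖Φ (φ.symm zs) - (starRingEnd ℂ) (Φ (φ.symm ys))‖ / ‖Φ (φ.symm zs) - Φ (φ.symm ys)‖) /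
      Real.log (‖φ.symm zs - (starRingEnd ℂ) (φ.symm ys)‖ / ‖φ.symm zs - φ.symm ys‖)| ≤ η := by
  rintro ⟨c, hc, hconv⟩ D D' hsub _h0 _h1 _hball φ _hφ A hA Φ _hΦ zs ys hzs hys hne η hη
  have hA' : A = φ.pullbackHull D' := hA
  subst hA'
  -- the two conformal images of the reference points
  have hu : φ.symm zs ∈ UpperHalfPlane.upperHalfPlaneSet := φ.symm_mapsTo (hsub hzs)
  have hv : φ.symm ys ∈ UpperHalfPlane.upperHalfPlaneSet := φ.symm_mapsTo (hsub hys)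
  have hne' : φ.symm zs ≠ φ.symm ys := fun h => hne (φ.symm.injOn (hsub hzs) (hsub hys) h)
  have huA : φ.symm zs ∈ UpperHalfPlane.upperHalfPlaneSet \ φ.pullbackHull D' := by
    rw [ConformalEquiv.diff_pullbackHull]
    exact ConformalEquiv.symm_mapsTo_pullbackDomain hsub hzs
  have hvA : φ.symm ys ∈ UpperHalfPlane.upperHalfPlaneSet \ φ.pullbackHull D' := by
    rw [ConformalEquiv.diff_pullbackHull]
    exact ConformalEquiv.symm_mapsTo_pullbackDomain hsub hys
  have hLpos : 0 < Real.log (‖φ.symm zs - (starRingEnd ℂ) (φ.symm ys)‖ / ‖φ.symm zs - φ.symm ys‖) :=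
    log_norm_sub_conj_div_pos hne' hu hv
  -- the limits `a = c·G_D(z*,y*) > 0` and `b = c·G_{D'}(z*,y*)`
  set L := Real.log (‖φ.symm zs - (starRingEnd ℂ) (φ.symm ys)‖ / ‖φ.symm zs - φ.symm ys‖) with hL
  set L' := Real.log (‖Φ (φ.symm zs) - (starRingEnd ℂ) (Φ (φ.symm ys))‖ /
    ‖Φ (φ.symm zs) - Φ (φ.symm ys)‖) with hL'
  set a := c * L with ha_def
  set b := c * L' with hb_def
  have ha : 0 < a := mul_pos hc hLpos
  have hab : 0 < a + |b| := by positivity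
  set e := min (a / 2) (η * a ^ 2 / (2 * (a + |b|))) with he_def
  have he : 0 < e := lt_min (half_pos ha) (by positivity)
  -- (GC) at `D' = D`, `ψ = φ`: the denominator
  obtain ⟨s₁, hs₁, hev₁⟩ := hconv D.toJordanDomain D.toJordanDomain subset_rfl φ zs ys (hsub hzs)
    (hsub hys) hne e he
  -- (GC) at `(D, D')`, `ψ = φ ∘ Φ⁻¹`: the numerator
  obtain ⟨s₂, hs₂, hev₂⟩ := hconv D.toJordanDomain D'.toJordanDomain hsub
    (Φ.symm.trans (φ.restrHull D' hsub)) zs ys hzs hys hne e he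
  refine ⟨min s₁ s₂, lt_min hs₁ hs₂, ?_⟩
  filter_upwards [hev₁, hev₂] with δ h₁ h₂ u v hdu hdv _hpos
  have h₁' := h₁ u v (lt_of_lt_of_le hdu (min_le_left _ _)) (lt_of_lt_of_le hdv (min_le_left _ _))
  have h₂' : |greenEntry (confinedGraph D.carrier D'.carrier δ) (meshDomainFinset D.carrier δ) u v -
      b| ≤ e :=
    h₂ u v (lt_of_lt_of_le hdu (min_le_right _ _)) (lt_of_lt_of_le hdv (min_le_right _ _))
  rw [confinedGraph_self_eq] at h₁'
  have key := abs_div_sub_div_le_of_abs_sub_le ha h₁' h₂' (min_le_left _ _)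
  -- `b/a = L'/L` and `2e(a + |b|)/a² ≤ η`
  have hba : b / a = L' / L := by
    rw [hb_def, ha_def, mul_div_mul_left _ _ hc.ne']
  have hbound : 2 * e * (a + |b|) / a ^ 2 ≤ η := by
    rw [div_le_iff₀ (pow_pos ha 2)]
    have h1 : e ≤ η * a ^ 2 / (2 * (a + |b|)) := min_le_right _ _
    have h2 : e * (2 * (a + |b|)) ≤ η * a ^ 2 := (le_div_iff₀ (by positivity)).1 h1
    linarith
  rw [hba] at key
  exact key.trans hbound

end Summit.CriticalPhenomena.SAWScalingLimit.Theorems.AvoidanceLimit.Anchor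

end
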